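import Literature.InformationTheory.QuantumCodes.SmallSetFlipFailure
import Literature.InformationTheory.QuantumCodes.AlphaPercolationIID
import HarnessLib

/-!
# Small-set-flip failure probability with the SHARP percolation constants (FGL18 Thm 17 as printed) and under
# independent noise (eq. (probiid))

Topic `Literature/InformationTheory/QuantumCodes` (venture QEC, row 04). Theorem-only. The generic reduction
"a small-set-flip decoder fails on `E` ⇒ `MaxConn_α(E) ≥ ⌊t₀⌋ + 1`" (`SmallSetFlip.hasAlphaCluster_of_not_corrects`,
FGL18 §3.3) was so far combined only with the crude Peierls form of the percolation bound
(`SmallSetFlip.sum_not_corrects_le_geometric`, constant `2Δ²`). Here it is combined with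

* `FGL18_theorem17_holds` — the printed local-stochastic constant `p_ls = (2^{-h(α)}/K(d))^{1/α}`:
  `SmallSetFlip.sum_not_corrects_le_sharp`;
* `fgl18_theorem17_iid` — the independent-noise refinement with `q = (1-p)^{d-1-α}p^α 2^{h(α)} K(d)`:
  `SmallSetFlip.sum_not_corrects_bernoulli_le`.

[cite: FawziGrospellierLeverrier2018] = arXiv:1711.08351v2, §3.3 (proof of Thm 1, p0012 L55-62; end of §4, p0014 L1-16).
-/

namespace Literature.InformationTheory.QuantumCodes

namespace SmallSetFlip

open Finset Matrix Literature.Probability.LatticeModels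

section Sharp

/-! The named fact `FGL18_theorem17` quantifies over `V : Type`; the sharp local-stochastic form is therefore stated
for qubit types in `Type`. -/

variable {Q C R : Type} [Fintype Q] [Fintype C] [Fintype R] [DecidableEq Q] [DecidableEq C]
  {G : SimpleGraph Q}

open Classical in
/-- **Failure probability ≤ the printed `α`-percolation bound (local stochastic noise, sharp constants).** With the
hypotheses of `sum_not_corrects_le_geometric` (adjacency graph `G` of degree `≤ d`, `d ≥ 3`; syndrome weight
`≤ w·|error|`; every run from an error of weight `≤ t₀` succeeds) and a locally stochastic weight of parameter
`0 < p < p_ls(d, α)`, `α = κ/(κ+w)`: `Σ_{E not corrected} μ(E) ≤ C |Q| (p/p_ls)^{α(⌊t₀⌋+1)}`,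
`1/C = (1 − e^{h(α)/α}p)(1 − (p/p_ls)^α)` ("`P[E not corrected] ≤ P[MaxConn_α(E) > t₀] ≤ C n (p/p₀)^{αt}` with
`p₀ = p_ls`"). [cite: FawziGrospellierLeverrier2018, proof of Thm 1 (end of §4, arXiv v2 p0014 L1-16) with Thm 17 eq. (problc)] -/
theorem sum_not_corrects_le_sharp [DecidableRel G.Adj] {Hs : Matrix C Q (ZMod 2)} {Hg : Matrix R Q (ZMod 2)}
    (hGX : ∀ c q q', q ≠ q' → Hs c q ≠ 0 → Hs c q' ≠ 0 → G.Adj q q')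
    (hGZ : ∀ g q q', q ≠ q' → Hg g q ≠ 0 → Hg g q' ≠ 0 → G.Adj q q')
    {κ w : ℝ} (hκ : 0 < κ) (hw0 : 0 ≤ w)
    (hw : ∀ v : Q → ZMod 2, (hammingNorm (Hs *ᵥ v) : ℝ) ≤ w * hammingNorm v)
    {t₀ : ℝ} (ht₀ : 0 ≤ t₀)
    (hcorr : ∀ (E' : Finset Q) (l' : List (Finset Q)), IsSSFRun κ Hs Hg (Hs *ᵥ flipVec E') l' →
      ((E'.card : ℝ) ≤ t₀) → flipVec E' + runOutput l' ∈ rowSpace Hg)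
    {D : Decoder (C → ZMod 2) (Q → ZMod 2)} (hD : IsSSFDecoder κ Hs Hg D)
    {d : ℕ} (hd : 3 ≤ d) (hΔ : ∀ x, G.degree x ≤ d)
    {μ : Finset Q → ℝ} {p : ℝ} (hμ : IsLocallyStochastic μ p) (hp0 : 0 < p)
    (hp : p < percolationValue d (κ / (κ + w))) :
    ∑ E ∈ univ.filter (fun E : Finset Q => ¬ D.Corrects (fun x => Hs *ᵥ x) (rowSpace Hg : Set _) (flipVec E)), μ E
      ≤ (1 / ((1 - Real.exp (Real.binEntropy (κ / (κ + w)) / (κ / (κ + w))) * p) *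
            (1 - (p / percolationValue d (κ / (κ + w))) ^ (κ / (κ + w))))) *
          Fintype.card Q * (p / percolationValue d (κ / (κ + w))) ^ ((κ / (κ + w)) * (⌊t₀⌋₊ + 1 : ℕ)) := by
  have hα0 : 0 < κ / (κ + w) := div_pos hκ (by linarith)
  have hα1 : κ / (κ + w) ≤ 1 := by rw [div_le_one (by linarith)]; linarith
  have h17 := FGL18_theorem17_holds Q G d hd hΔ (κ / (κ + w)) hα0 hα1 (⌊t₀⌋₊ + 1) (by omega) p μ hp0 hp hμ
  refine le_trans ?_ h17
  refine Finset.sum_le_sum_of_subset_of_nonneg ?_ fun E _ _ => hμ.nonneg E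
  intro E hE
  rw [Finset.mem_filter] at hE ⊢
  exact ⟨hE.1, hasAlphaCluster_of_not_corrects hGX hGZ hκ hw0 hw ht₀ hcorr hD hE.2⟩

end Sharp

section IID

variable {Q C R : Type*} [Fintype Q] [Fintype C] [Fintype R] [DecidableEq Q] [DecidableEq C]
  {G : SimpleGraph Q}

open Classical in
/-- **Failure probability under INDEPENDENT noise (eq. (probiid)).** Same hypotheses, error sets drawn from
`bernoulliWeight p` with `0 < p < α/(d−1)` and `q = (1-p)^{d-1-α} p^α e^{h(α)} (d-1)(1+1/(d-2))^{d-2} < 1`,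
`α = κ/(κ+w)`: `Σ_{E not corrected} p^|E|(1-p)^{|Q|-|E|} ≤ |Q| ((d-1)/(d-2))² q^{⌊t₀⌋+1}/(1-q)` (Theorem 1 "in the
independent error model"). [cite: FawziGrospellierLeverrier2018, proof of Thm 1 (end of §4, arXiv v2 p0014 L1-16) with Thm 17 eq. (probiid)] -/
theorem sum_not_corrects_bernoulli_le [DecidableRel G.Adj] {Hs : Matrix C Q (ZMod 2)} {Hg : Matrix R Q (ZMod 2)}
    (hGX : ∀ c q q', q ≠ q' → Hs c q ≠ 0 → Hs c q' ≠ 0 → G.Adj q q')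
    (hGZ : ∀ g q q', q ≠ q' → Hg g q ≠ 0 → Hg g q' ≠ 0 → G.Adj q q')
    {κ w : ℝ} (hκ : 0 < κ) (hw0 : 0 ≤ w)
    (hw : ∀ v : Q → ZMod 2, (hammingNorm (Hs *ᵥ v) : ℝ) ≤ w * hammingNorm v)
    {t₀ : ℝ} (ht₀ : 0 ≤ t₀)
    (hcorr : ∀ (E' : Finset Q) (l' : List (Finset Q)), IsSSFRun κ Hs Hg (Hs *ᵥ flipVec E') l' →
      ((E'.card : ℝ) ≤ t₀) → flipVec E' + runOutput l' ∈ rowSpace Hg)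
    {D : Decoder (C → ZMod 2) (Q → ZMod 2)} (hD : IsSSFDecoder κ Hs Hg D)
    {d : ℕ} (hd : 3 ≤ d) (hΔ : ∀ x, G.degree x ≤ d)
    {p : ℝ} (hp0 : 0 < p) (hpα : p < (κ / (κ + w)) / ((d : ℝ) - 1))
    (hq : (1 - p) ^ ((d : ℝ) - 1 - κ / (κ + w)) * p ^ (κ / (κ + w)) * Real.exp (Real.binEntropy (κ / (κ + w)))
      * (((d : ℝ) - 1) * (1 + 1 / ((d : ℝ) - 2)) ^ (d - 2)) < 1) :
    ∑ E ∈ univ.filter (fun E : Finset Q => ¬ D.Corrects (fun x => Hs *ᵥ x) (rowSpace Hg : Set _) (flipVec E)),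
        bernoulliWeight p E
      ≤ (Fintype.card Q : ℝ) * (((d : ℝ) - 1) / ((d : ℝ) - 2)) ^ 2 *
        (((1 - p) ^ ((d : ℝ) - 1 - κ / (κ + w)) * p ^ (κ / (κ + w)) * Real.exp (Real.binEntropy (κ / (κ + w)))
            * (((d : ℝ) - 1) * (1 + 1 / ((d : ℝ) - 2)) ^ (d - 2))) ^ (⌊t₀⌋₊ + 1)
        / (1 - (1 - p) ^ ((d : ℝ) - 1 - κ / (κ + w)) * p ^ (κ / (κ + w)) * Real.exp (Real.binEntropy (κ / (κ + w)))
            * (((d : ℝ) - 1) * (1 + 1 / ((d : ℝ) - 2)) ^ (d - 2)))) := by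
  have hα0 : 0 < κ / (κ + w) := div_pos hκ (by linarith)
  have hα1 : κ / (κ + w) ≤ 1 := by rw [div_le_one (by linarith)]; linarith
  have hd' : (3 : ℝ) ≤ d := by exact_mod_cast hd
  have hp1 : p ≤ 1 := by
    have h1 : κ / (κ + w) / ((d : ℝ) - 1) ≤ 1 / 2 := by
      rw [div_le_iff₀ (by linarith)]; linarith
    linarith
  have h17 := fgl18_theorem17_iid G hd hΔ hα0 hα1 (t := ⌊t₀⌋₊ + 1) (by omega) hp0 hpα hq
  refine le_trans ?_ h17
  refine Finset.sum_le_sum_of_subset_of_nonneg ?_ fun E _ _ => bernoulliWeight_nonneg hp0.le hp1 E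
  intro E hE
  rw [Finset.mem_filter] at hE ⊢
  exact ⟨hE.1, hasAlphaCluster_of_not_corrects hGX hGZ hκ hw0 hw ht₀ hcorr hD hE.2⟩

end IID

end SmallSetFlip

end Literature.InformationTheory.QuantumCodes
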